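import Summits.BirchSwinnertonDyer.BirchSwinnertonDyer.Theses.GenusKolyvaginAtTwo
import HarnessLib

/-!
# R9-L KIT (seat `bsd-line-gk2-p2` g22, 2026-08-30) — the L⁺_T side of R9: L⁺_T′, Q4_T″, supply⁺″ with the TRANSPOSITION-DEEP
# Kolyvagin witness clause, elaborated against route `GenusKolyvaginAtTwo` rev 42 (local `def`s = proposed item texts; glue″ proved)

NOT a proposal to the gate (sketch for the LEAD gk2-p1 g20, the route pen `bsd-idea-1` g22 / planner-of-record `-imc`).  BSD is NOT proved
by any of this; nothing is closed; L⁺_T (stmt-BirchSwinnertonDyer-23379) AS FILED is NOT proved.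

WHY (addendum to the LEAD's `RESTATEMENT-R9-posdisc-cut-g20.md`, which leaves L⁺_T 23379 UNCHANGED).  L⁺_T's only known road is (E4)⁺ =
LINE 18's road (E4) — which CLOSED the Δ<0 lower half L_T (p744020) — ported to Δ>0.  Road (E4)'s K-side capstone
`pow_dvd_natCard_sha_of_kolyvaginSupplies_of_orthogonal_of_rank_le_one` (p741898) is SIGN-FREE; its three feeders are not: (R) `rank E(K) ≤ 1`
needs Q2 (+ on Δ<0: Q5R, NPh); X-ORTH∃ and KS need, at every Kolyvagin place they use, that `Frob_ℓ` be a REGULAR involution of `E[2^M]`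
(`E[2^M]` free over `ℤ/2^M[Frob_ℓ]`; `…RTRegularFrameAtTwo.exists_regular_frame_liftAutPlace` is the ONE lemma through which `Δ < 0` /
`FrobEqFrobInfty` enter X-ORTH).  On Δ<0 Gross's class `Frob(ℓ) = Frob(∞)` IS regular; on Δ>0 it is NOT (`c₀` fixes `E[2]`,
`…PosTComplexConjugationNotRegular`), and the regular class is «`Frob_ℓ` moves a point of `E[2]`» (a TRANSPOSITION of `E[2] ∖ 0`; with
`2 ∣ a_ℓ` automatic).  The W-UP obstruction of LINE 18 (memos `plus-descent-wup-frobtrivial-gk2p2.md`, `plus-descent-wup2-gk2p5.md`: at a prime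
with `Frob_ℓ = 1` on `E[2]` the descent `H¹(ℚ_ℓ, E[2]) → H¹(K_λ, E[2])` kills all of `H¹_ur`, so no swap engine upgrades such a witness) applies
VERBATIM on Δ>0 to Gross-class witness primes.  Hence, exactly as rev 37 (β″) did for L_T, the Δ>0 triple must carry the witness in
TRANSPOSITION-DEEP currency, and L⁺_T must get the antecedent Q2, the NPh binders and the cut (for `rank E(K) ≤ 1`:
`…PosTOnCut.exists_frame_of_cut` + `mordellWeilRank_eq_zero_of_two_pow_smul_selmer_eq_zero` ∘ B2Q⁺):

* L⁺_T′ `PowDvdShaCardAtTwoPosT'` := the LEAD's Q4_T′ frame (Q2 first; `v h2v hNv hmult`; `0 < W.Δ`; the cut `w = 1`, `Wd`, `#Sel₂(Wd) = 2`,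
  `padicValNat 2 Wd.tamagawaProduct = 0`) with the Kolyvagin witness clause
  `∀ ℓ ∈ n.primeFactors, Zhang2014.IsKolyvaginPrime N W K 2 ℓ ∧ 2 ≤ Zhang2014.kolyvaginIndex W 2 ℓ ∧ (∃ v 𝔓 h, ℓ ∈ v ∧ 𝔓 ∈ v.primesAbove ∧
  IsArithFrobAt (𝓞 ℚ) h 𝔓 ∧ ∃ u : E[2], h • u ≠ u)` and conclusion `2^(2M₀) ∣ #Ш(E/K)[2^∞]`;
* Q4_T″ `KolyvaginExactAtTwoPosDiscT''` := the LEAD's Q4_T′ with the SAME witness clause (else glue″ fails);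
* supply⁺″ `GenusPrimitiveSupplyAtTwoPosDiscShallow'` := the LEAD's supply⁺ with the SAME witness clause in its output
  (its stub C⁺ = Gross's Question 11 at `2` with a transposition-deep witness — the same grade as 23491's deep Gross witness on Δ<0);
* glue″ `kolyvaginExactAtTwoPosDiscTOfHalves''` : U⁺_T′ → L⁺_T′ → Q4_T″ (PROVED below; U⁺_T′ = the LEAD's text, unchanged).
`closesN` composes unchanged (its Δ>0 branch passes supply⁺'s witness to Q4_T verbatim).

The transposition clause is stated in Literature vocabulary only (`IsDedekindDomain.HeightOneSpectrum.primesAbove`,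
`Literature.NumberTheory.GaloisRepresentations.absIntegers`, Mathlib `IsArithFrobAt`, `WeierstrassCurve.geomTorsion`); it is the per-prime
output shape of gk2-p4 g23's regular signed pair-Čebotarev (p754753) minus the sign data, and on Δ<0 it FOLLOWS from Gross's (3.2)
(`GenusKolySign.exists_twoTorsion_frob_smul_ne_of_frobEqFrobInfty_of_Δ_neg`), so a sign-free (E4) stated with it specialises to L_T.
-/

set_option linter.dupNamespace false

namespace Summit.BirchSwinnertonDyer.BirchSwinnertonDyer.Cruxes.KolyvaginExactAtTwoPosDiscT.R9L

open Summit.BirchSwinnertonDyer.BirchSwinnertonDyer.Theses.GenusKolyvaginAtTwo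
open WeierstrassCurve Literature.NumberTheory.EllipticCurves Literature.NumberTheory.EllipticCurves.ModularForms

/-- The LEAD's PROPOSED U⁺_T′ (R9 §1, verbatim from `SketchPos_R9.lean`; restatement of stmt-BirchSwinnertonDyer-23378 onto the cut). -/
def ShaCardDvdPowAtTwoPosT' : Prop :=
  KolyvaginRelationAtTwo → ∀ (W : WeierstrassCurve ℚ) [W.IsElliptic] [W.IsGloballyMinimal] [NeZero (W.conductorNorm ℤ)], ¬ W.HasCM → Odd W.tamagawaProduct → ∀ (v : IsDedekindDomain.HeightOneSpectrum (NumberField.RingOfIntegers ℚ)), ((2 : ℕ) : NumberField.RingOfIntegers ℚ) ∉ v.asIdeal → ((W.conductorNorm ℤ : ℕ) : NumberField.RingOfIntegers ℚ) ∈ v.asIdeal → W.HasMultiplicativeReductionAt v → 0 < W.Δ → ∀ (K : Type) [Field K] [NumberField K], Literature.NumberTheory.EllipticCurves.IsImaginaryQuadratic K → Odd (NumberField.discr K) → NumberField.discr K ≠ -3 → Literature.NumberTheory.EllipticCurves.SatisfiesHeegnerHypothesis (W.conductorNorm ℤ) K → ¬ IsSquare ((NumberField.discr K : ℚ) * -|W.Δ|)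 → ¬ IsSquare ((NumberField.discr K : ℚ) * (-(2 * |W.Δ|))) → (∀ n : ℕ, 0 < n → W.HasSurjectiveModNGaloisRep ((2 : ℤ) ^ n)) → ∀ (Dt : Literature.NumberTheory.EllipticCurves.ModularForms.ModularParametrizationData W (W.conductorNorm ℤ)) (β : ℤ) (ι : K →+* ℂ) (d₁ : Literature.NumberTheory.EllipticCurves.KolyvaginHeegnerData Dt β ι 1), ¬ IsOfFinAddOrder d₁.derivedPoint → ∀ (M₀ : ℕ), (∃ Q : (W.baseChange (Literature.NumberTheory.EllipticCurves.ringClassField K ι 1)).toAffine.Point, ((2 ^ M₀ : ℕ) : ℤ) • Q = d₁.derivedPoint) → (¬ ∃ Q : (W.baseChange (Literature.NumberTheory.EllipticCurves.ringClassField K ι 1)).toAffine.Point, ((2 ^ (M₀ + 1) : ℕ) : ℤ) • Q = d₁.derivedPoint) → W.rootNumber = 1 → ∀ (Wd : WeierstrassCurve ℚ) [Wd.IsElliptic] [Wd.IsGloballyMinimal], (∃ C : WeierstrassCurve.VariableChange ℚ, C • W.quadraticTwist (NumberField.discr K : ℚ) = Wd) → Nat.card (Wd.selmerGroup 2) = 2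 → padicValNat 2 Wd.tamagawaProduct = 0 → Nat.card (AddCommGroup.primaryComponent (W.baseChange K).sha 2) ∣ 2 ^ (2 * M₀)

/-- PROPOSED L⁺_T′ (restatement of stmt-BirchSwinnertonDyer-23379): Q4_T′'s frame + the TRANSPOSITION-DEEP witness clause, conclusion `2^(2M₀) ∣ #Ш`. -/
def PowDvdShaCardAtTwoPosT' : Prop :=
  KolyvaginRelationAtTwo → ∀ (W : WeierstrassCurve ℚ) [W.IsElliptic] [W.IsGloballyMinimal] [NeZero (W.conductorNorm ℤ)], ¬ W.HasCM → Odd W.tamagawaProduct → ∀ (v : IsDedekindDomain.HeightOneSpectrum (NumberField.RingOfIntegers ℚ)), ((2 : ℕ) : NumberField.RingOfIntegers ℚ) ∉ v.asIdeal → ((W.conductorNorm ℤ : ℕ) : NumberField.RingOfIntegers ℚ) ∈ v.asIdeal → W.HasMultiplicativeReductionAt v → 0 < W.Δ → ∀ (K : Type) [Field K] [NumberField K], Literature.NumberTheory.EllipticCurves.IsImaginaryQuadratic K → Odd (NumberField.discr K) → NumberField.discr K ≠ -3 → Literature.NumberTheory.EllipticCurves.SatisfiesHeegnerHypothesis (W.conductorNorm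 ℤ) K → ¬ IsSquare ((NumberField.discr K : ℚ) * -|W.Δ|) → ¬ IsSquare ((NumberField.discr K : ℚ) * (-(2 * |W.Δ|))) → (∀ n : ℕ, 0 < n → W.HasSurjectiveModNGaloisRep ((2 : ℤ) ^ n)) → ∀ (Dt : Literature.NumberTheory.EllipticCurves.ModularForms.ModularParametrizationData W (W.conductorNorm ℤ)) (β : ℤ) (ι : K →+* ℂ) (d₁ : Literature.NumberTheory.EllipticCurves.KolyvaginHeegnerData Dt β ι 1), ¬ IsOfFinAddOrder d₁.derivedPoint → ∀ (M₀ : ℕ), (∃ Q : (W.baseChange (Literature.NumberTheory.EllipticCurves.ringClassField K ι 1)).toAffine.Point, ((2 ^ M₀ : ℕ) : ℤ) • Q = d₁.derivedPoint) → (¬ ∃ Q : (W.baseChange (Literature.NumberTheory.EllipticCurves.ringClassField K ι 1)).toAffine.Point, ((2 ^ (M₀ + 1) : ℕ) : ℤ) • Q = d₁.derivedPoint) → W.rootNumber = 1 → ∀ (Wd : WeierstrassCurve ℚ) [Wd.IsElliptic] [Wd.IsGloballyMinimal], (∃ C : WeierstrassCurve.VariableChange ℚ, C • W.quadraticTwist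 (NumberField.discr K : ℚ) = Wd) → Nat.card (Wd.selmerGroup 2) = 2 → padicValNat 2 Wd.tamagawaProduct = 0 → ∀ (n : ℕ) (d : Literature.NumberTheory.EllipticCurves.KolyvaginHeegnerData Dt β ι n), Squarefree n → (∀ ℓ ∈ n.primeFactors, Literature.NumberTheory.EllipticCurves.Zhang2014.IsKolyvaginPrime (W.conductorNorm ℤ) W K 2 ℓ ∧ 2 ≤ Literature.NumberTheory.EllipticCurves.Zhang2014.kolyvaginIndex W 2 ℓ ∧ ∃ (v : IsDedekindDomain.HeightOneSpectrum (NumberField.RingOfIntegers ℚ)) (𝔓 : Ideal (Literature.NumberTheory.GaloisRepresentations.absIntegers (NumberField.RingOfIntegers ℚ) ℚ)) (h : Field.absoluteGaloisGroup ℚ), ((ℓ : ℕ) : NumberField.RingOfIntegers ℚ) ∈ v.asIdeal ∧ 𝔓 ∈ v.primesAbove ∧ IsArithFrobAt (NumberField.RingOfIntegers ℚ) h 𝔓 ∧ ∃ u : W.geomTorsion ((2 : ℕ) : ℤ), h • u ≠ u) → (¬ ∃ Q : (W.baseChange (Literature.NumberTheory.EllipticCurves.ringClassField K ι n)).toAffine.Point,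 (2 : ℤ) • Q = d.derivedPoint) → 2 ^ (2 * M₀) ∣ Nat.card (AddCommGroup.primaryComponent (W.baseChange K).sha 2)

/-- PROPOSED Q4_T″ (restatement of stmt-BirchSwinnertonDyer-23240): the LEAD's Q4_T′ with the TRANSPOSITION-DEEP witness clause. -/
def KolyvaginExactAtTwoPosDiscT'' : Prop :=
  KolyvaginRelationAtTwo → ∀ (W : WeierstrassCurve ℚ) [W.IsElliptic] [W.IsGloballyMinimal] [NeZero (W.conductorNorm ℤ)], ¬ W.HasCM → Odd W.tamagawaProduct → ∀ (v : IsDedekindDomain.HeightOneSpectrum (NumberField.RingOfIntegers ℚ)), ((2 : ℕ) : NumberField.RingOfIntegers ℚ) ∉ v.asIdeal → ((W.conductorNorm ℤ : ℕ) : NumberField.RingOfIntegers ℚ) ∈ v.asIdeal → W.HasMultiplicativeReductionAt v → 0 < W.Δ → ∀ (K : Type) [Field K] [NumberField K], Literature.NumberTheory.EllipticCurves.IsImaginaryQuadratic K → Odd (NumberField.discr K) → NumberField.discr K ≠ -3 → Literature.NumberTheory.EllipticCurves.SatisfiesHeegnerHypothesis (W.conductorNorm ℤ) K → ¬ IsSquare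 ((NumberField.discr K : ℚ) * -|W.Δ|) → ¬ IsSquare ((NumberField.discr K : ℚ) * (-(2 * |W.Δ|))) → (∀ n : ℕ, 0 < n → W.HasSurjectiveModNGaloisRep ((2 : ℤ) ^ n)) → ∀ (Dt : Literature.NumberTheory.EllipticCurves.ModularForms.ModularParametrizationData W (W.conductorNorm ℤ)) (β : ℤ) (ι : K →+* ℂ) (d₁ : Literature.NumberTheory.EllipticCurves.KolyvaginHeegnerData Dt β ι 1), ¬ IsOfFinAddOrder d₁.derivedPoint → ∀ (M₀ : ℕ), (∃ Q : (W.baseChange (Literature.NumberTheory.EllipticCurves.ringClassField K ι 1)).toAffine.Point, ((2 ^ M₀ : ℕ) : ℤ) • Q = d₁.derivedPoint) → (¬ ∃ Q : (W.baseChange (Literature.NumberTheory.EllipticCurves.ringClassField K ι 1)).toAffine.Point, ((2 ^ (M₀ + 1) : ℕ) : ℤ) • Q = d₁.derivedPoint) → W.rootNumber = 1 → ∀ (Wd : WeierstrassCurve ℚ) [Wd.IsElliptic] [Wd.IsGloballyMinimal], (∃ C : WeierstrassCurve.VariableChange ℚ, C • W.quadraticTwist (NumberField.discr K : ℚ) =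 Wd) → Nat.card (Wd.selmerGroup 2) = 2 → padicValNat 2 Wd.tamagawaProduct = 0 → ∀ (n : ℕ) (d : Literature.NumberTheory.EllipticCurves.KolyvaginHeegnerData Dt β ι n), Squarefree n → (∀ ℓ ∈ n.primeFactors, Literature.NumberTheory.EllipticCurves.Zhang2014.IsKolyvaginPrime (W.conductorNorm ℤ) W K 2 ℓ ∧ 2 ≤ Literature.NumberTheory.EllipticCurves.Zhang2014.kolyvaginIndex W 2 ℓ ∧ ∃ (v : IsDedekindDomain.HeightOneSpectrum (NumberField.RingOfIntegers ℚ)) (𝔓 : Ideal (Literature.NumberTheory.GaloisRepresentations.absIntegers (NumberField.RingOfIntegers ℚ) ℚ)) (h : Field.absoluteGaloisGroup ℚ), ((ℓ : ℕ) : NumberField.RingOfIntegers ℚ) ∈ v.asIdeal ∧ 𝔓 ∈ v.primesAbove ∧ IsArithFrobAt (NumberField.RingOfIntegers ℚ) h 𝔓 ∧ ∃ u : W.geomTorsion ((2 : ℕ) : ℤ), h • u ≠ u) → (¬ ∃ Q : (W.baseChange (Literature.NumberTheory.EllipticCurves.ringClassField K ι n)).toAffine.Point, (2 : ℤ) • Q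 = d.derivedPoint) → Nat.card (AddCommGroup.primaryComponent (W.baseChange K).sha 2) = 2 ^ (2 * M₀)

/-- PROPOSED glue″ (re-proof of stmt-BirchSwinnertonDyer-23380 against the restated texts): U⁺_T′ → L⁺_T′ → Q4_T″, by `Nat.dvd_antisymm`. -/
theorem kolyvaginExactAtTwoPosDiscTOfHalves'' : ShaCardDvdPowAtTwoPosT' → PowDvdShaCardAtTwoPosT' → KolyvaginExactAtTwoPosDiscT'' := by
  intro hU hL hQ2 W _ _ _ hcm hT v h2v hNv hmult hpos K _ _ hIQ hodd h3 hHe hsq1 hsq2 hρ Dt β ι d₁ hy M₀ hdiv hndiv hw Wd _ _ hWd hSel hTam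
    n d hn hKoly hPn
  exact Nat.dvd_antisymm (hU hQ2 W hcm hT v h2v hNv hmult hpos K hIQ hodd h3 hHe hsq1 hsq2 hρ Dt β ι d₁ hy M₀ hdiv hndiv hw Wd hWd hSel hTam)
    (hL hQ2 W hcm hT v h2v hNv hmult hpos K hIQ hodd h3 hHe hsq1 hsq2 hρ Dt β ι d₁ hy M₀ hdiv hndiv hw Wd hWd hSel hTam n d hn hKoly hPn)

/-- L⁺_T′ is WEAKER than L⁺_T as filed (more hypotheses): the filed text implies the restated one (so nothing already landed is lost). -/
theorem powDvdShaCardAtTwoPosT'_of_filed (h : PowDvdShaCardAtTwoPosT) : PowDvdShaCardAtTwoPosT' := by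
  intro _hQ2 W _ _ _ hcm hT _v _h2v _hNv _hmult hpos K _ _ hIQ hodd h3 hHe hsq1 hsq2 hρ Dt β ι d₁ hy M₀ hdiv hndiv _hw _Wd _ _ _hWd _hSel _hTam
    n d hn hKoly hPn
  exact h W hcm hT hpos K hIQ hodd h3 hHe hsq1 hsq2 hρ Dt β ι d₁ hy M₀ hdiv hndiv n d hn (fun ℓ hℓ ↦ (hKoly ℓ hℓ).1) hPn

/-- PROPOSED supply⁺″ (the LEAD's `GenusPrimitiveSupplyAtTwoPosDiscShallow` with the TRANSPOSITION-DEEP witness clause in its output). -/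
def GenusPrimitiveSupplyAtTwoPosDiscShallow' : Prop :=
  ∀ (W : WeierstrassCurve ℚ) [W.IsElliptic] [W.IsGloballyMinimal] [NeZero (W.conductorNorm ℤ)], ¬ W.HasCM → W.analyticRank = 0 → (∀ n : ℕ, 0 < n → W.HasSurjectiveModNGaloisRep ((2 : ℤ) ^ n)) → Odd W.tamagawaProduct → 0 < W.Δ → (∃ Dt : Literature.NumberTheory.EllipticCurves.ModularForms.ModularParametrizationData W (W.conductorNorm ℤ), (∀ z ∈ Dt.L.lattice, ∃ w ∈ Literature.NumberTheory.EllipticCurves.ModularForms.periodLattice Dt.f, z = (Dt.c : ℂ) * w) ∧ Odd Dt.c) → (Nat.card (W.selmerGroup 2) = 1 ∨ Nat.card (W.selmerGroup 2) = 4) → ∃ (K : Type) (_ : Field K) (_ : NumberField K), Literature.NumberTheory.EllipticCurves.IsImaginaryQuadratic K ∧ Odd (NumberField.discr K) ∧ NumberField.discr K ≠ -3 ∧ Literature.NumberTheory.EllipticCurves.SatisfiesHeegnerHypothesis (W.conductorNorm ℤ) K ∧ ¬ IsSquare ((NumberField.discr K : ℚ) * -|W.Δ|) ∧ ¬ IsSquare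 ((NumberField.discr K : ℚ) * (-(2 * |W.Δ|))) ∧ ∃ (Dt : Literature.NumberTheory.EllipticCurves.ModularForms.ModularParametrizationData W (W.conductorNorm ℤ)) (β : ℤ) (ι : K →+* ℂ) (d₁ : Literature.NumberTheory.EllipticCurves.KolyvaginHeegnerData Dt β ι 1), (∀ z ∈ Dt.L.lattice, ∃ w ∈ Literature.NumberTheory.EllipticCurves.ModularForms.periodLattice Dt.f, z = (Dt.c : ℂ) * w) ∧ Odd Dt.c ∧ ¬ IsOfFinAddOrder d₁.derivedPoint ∧ ∃ M₀ : ℕ, (∃ Q : (W.baseChange (Literature.NumberTheory.EllipticCurves.ringClassField K ι 1)).toAffine.Point, ((2 ^ M₀ : ℕ) : ℤ) • Q = d₁.derivedPoint) ∧ (¬ ∃ Q : (W.baseChange (Literature.NumberTheory.EllipticCurves.ringClassField K ι 1)).toAffine.Point, ((2 ^ (M₀ + 1) : ℕ) : ℤ) • Q = d₁.derivedPoint) ∧ ∃ (n : ℕ) (d : Literature.NumberTheory.EllipticCurves.KolyvaginHeegnerData Dt β ι n), Squarefree n ∧ (∀ ℓ ∈ n.primeFactors, Literature.NumberTheory.EllipticCurves.Zhang2014.IsKolyvaginPrime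 (W.conductorNorm ℤ) W K 2 ℓ ∧ 2 ≤ Literature.NumberTheory.EllipticCurves.Zhang2014.kolyvaginIndex W 2 ℓ ∧ ∃ (v : IsDedekindDomain.HeightOneSpectrum (NumberField.RingOfIntegers ℚ)) (𝔓 : Ideal (Literature.NumberTheory.GaloisRepresentations.absIntegers (NumberField.RingOfIntegers ℚ) ℚ)) (h : Field.absoluteGaloisGroup ℚ), ((ℓ : ℕ) : NumberField.RingOfIntegers ℚ) ∈ v.asIdeal ∧ 𝔓 ∈ v.primesAbove ∧ IsArithFrobAt (NumberField.RingOfIntegers ℚ) h 𝔓 ∧ ∃ u : W.geomTorsion ((2 : ℕ) : ℤ), h • u ≠ u) ∧ (¬ ∃ Q : (W.baseChange (Literature.NumberTheory.EllipticCurves.ringClassField K ι n)).toAffine.Point, (2 : ℤ) • Q = d.derivedPoint) ∧ ∃ (Wd : WeierstrassCurve ℚ) (_ : Wd.IsElliptic) (_ : Wd.IsGloballyMinimal), (∃ C : WeierstrassCurve.VariableChange ℚ, C • W.quadraticTwist (NumberField.discr K : ℚ) = Wd) ∧ ¬ Wd.HasCM ∧ Wd.analyticRank = 1 ∧ Nat.card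 (Wd.selmerGroup 2) = 2 ∧ padicValNat 2 Wd.tamagawaProduct = 0

end Summit.BirchSwinnertonDyer.BirchSwinnertonDyer.Cruxes.KolyvaginExactAtTwoPosDiscT.R9L
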